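import Summits.BirchSwinnertonDyer.BirchSwinnertonDyer.Theorems.Rank2ObservatoryRank3WitnessT4
import HarnessLib

/-!
# BirchSwinnertonDyer — rank ≥ 2 observatory: rank-2 kernel certificates for the torsion classes `ℤ/2`, `ℤ/4`

HONEST FRAMING: per-curve certified theorems and census instruments; no claim on BSD in rank ≥ 2.

The rank-2 kernel certificates of `Rank2ObservatoryReductionWitness[2|3]` / `…KernelAnnihilator2`
test a point `R` at `2`-exponent `u = 1` by `R̃ ∉ 2Ẽ(𝔽_q) + Ẽ(𝔽_q)[2]` (`xCosetFree`), which is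
stronger than the independence criterion needs when `E(ℚ)[2] ≅ ℤ/2` but `Ẽ(𝔽_q)[2]` is bigger, and
have no form at all for `E(ℚ)_tors ⊇ ℤ/4` (`u = 2`). For the `218` rank-2 census rows of conductor
`< 25000` left out of scope by those files with `E(ℚ)[2^∞] ≅ ℤ/2` or `ℤ/4`, this file gives the
rank-2 analogues of the rank-3 certificates `three_le_mordellWeilRank_of_kernelCertT3` /
`…T4` (cell `b2b-bsdr2-cert-2`): coset tests modulo the RATIONAL `2`-power torsion only
(`tCosetFree`: one good prime `q` per point with `R̃ ∉ 2Ẽ(𝔽_q)` and `R̃ + T̃ ∉ 2Ẽ(𝔽_q)`, resp.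
`R̃ + T̃₄ ∉ 2Ẽ(𝔽_q)`), the sum `P₁ + P₂` supplied by a chord certificate mod `q`. New here:
`four_nsmul_eq_zero_of_fourTorsionWitness` (no rational point of order `8` from the `ℤ/4` data plus
ONE good prime `ℓ₂` at which `T̃₄` is no double), the sharpened annihilator
`torsion_zsmul_eq_zero_of_fourTorsionWitness` (`4m` kills `E(ℚ)_tors` whatever the `2`-exponent of
the point-count annihilator `t = 2^e·m`), and the two certificates
`two_le_mordellWeilRank_of_kernelCertT3` (`E(ℚ)[2] = {O, T}`, `u = 1`) and
`two_le_mordellWeilRank_of_kernelCertT4` (`E(ℚ)[4] = ⟨T₄⟩`, `u = 2`). Integral points throughout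
(non-integral generators / torsion points are handled per curve on a scaled model via
`mordellWeilRank_scaleModel`). Sorry-free.
References: Silverman AEC (2009) III.2.3, VII.3.1(b), VII.3.4, VIII.6.7; Cremona (1997) §3.5.
-/

-- single-conjunct summit: `Summit.BirchSwinnertonDyer.BirchSwinnertonDyer.…` repeats the name by design
set_option linter.dupNamespace false

namespace Summit.BirchSwinnertonDyer.BirchSwinnertonDyer.Rank2Observatory

open WeierstrassCurve Literature.NumberTheory.EllipticCurves

section FourTorsionWitness

variable (V : WeierstrassCurve ℤ)

open scoped Classical in
/-- **No point of order `8` in `E(ℚ)`** from the `ℤ/4` data (`T`, `T₄` with `2T₄ = T` by `intTangent`,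
`E(ℚ)[4] = {O, ±T₄, T}` certified at the good odd prime `ℓ₁`) and a good prime `ℓ₂` at which `T̃₄` is
no double (`xDoubleFree V ℓ₂ x₄`): `8 • w = 0 → 4 • w = 0` (`2w ∈ E(ℚ)[4]`; `2w = ±T₄` would make
`T̃₄` a double mod `ℓ₂`, so `2w ∈ {O, T}` and `4w = 0`). [cite: SilvermanAEC2009, Prop. VII.3.1(b)] -/
theorem four_nsmul_eq_zero_of_fourTorsionWitness {xT yT x₄ y₄ : ℤ}
    (hT : yT ^ 2 + V.a₁ * xT * yT + V.a₃ * yT = xT ^ 3 + V.a₂ * xT ^ 2 + V.a₄ * xT + V.a₆)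
    (hT2 : 2 * yT + V.a₁ * xT + V.a₃ = 0)
    (h₄ : y₄ ^ 2 + V.a₁ * x₄ * y₄ + V.a₃ * y₄ = x₄ ^ 3 + V.a₂ * x₄ ^ 2 + V.a₄ * x₄ + V.a₆)
    (htan : intTangent V x₄ y₄ xT yT = true)
    (ℓ₁ : ℕ) [Fact ℓ₁.Prime] (hℓ₁ : ¬ (ℓ₁ : ℤ) ∣ V.Δ) (hodd : ℓ₁ ≠ 2)
    (hB₁ : twoTorsionOnlyB V ℓ₁ xT yT = true) (hB₂ : halfTOnlyB V ℓ₁ xT x₄ y₄ = true)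
    (ℓ₂ : ℕ) [Fact ℓ₂.Prime] (hℓ₂ : ¬ (ℓ₂ : ℤ) ∣ V.Δ) (hB₃ : xDoubleFree V ℓ₂ (x₄ : ZMod ℓ₂) = true)
    (w : (V.map (Int.castRingHom ℚ)).toAffine.Point) (h : 8 • w = 0) : 4 • w = 0 := by
  have hΔ : V.Δ ≠ 0 := Δ_ne_zero_of_not_dvd V hℓ₁
  haveI := isElliptic_rat V hΔ
  have e₄ : V.toAffine.Equation x₄ y₄ := (Affine.equation_iff x₄ y₄).mpr h₄
  set T₄ : (V.map (Int.castRingHom ℚ)).toAffine.Point :=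
    .some (x₄ : ℚ) (y₄ : ℚ) (nonsingular_rat_of_eq V hΔ h₄) with hT₄def
  set T : (V.map (Int.castRingHom ℚ)).toAffine.Point :=
    .some (xT : ℚ) (yT : ℚ) (nonsingular_rat_of_eq V hΔ hT) with hTdef
  have h2T : 2 • T = 0 := two_nsmul_some_eq_zero V hΔ hT hT2
  -- `2w` is `4`-torsion
  have h42w : (2 : ℤ) ^ 2 • (2 • w) = 0 := by
    have : (4 : ℕ) • (2 • w) = 0 := by
      rw [← mul_nsmul, show (4 : ℕ) * 2 = 8 from rfl]; exact h
    rw [show ((2 : ℤ) ^ 2) = ((4 : ℕ) : ℤ) by norm_num, natCast_zsmul]; exact this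
  -- `T̃₄` is no double mod `ℓ₂`: neither `2w = T₄` nor `2w = -T₄`
  have hnot : ∀ v : (V.map (Int.castRingHom ℚ)).toAffine.Point, 2 • v ≠ T₄ := by
    intro v hv
    have hmem : (Affine.Point.some (x₄ : ZMod ℓ₂) (y₄ : ZMod ℓ₂)
        (nonsingular_zmod_of_equation V ℓ₂ hℓ₂ e₄) :
          (V.map (Int.castRingHom (ZMod ℓ₂))).toAffine.Point)
          ∈ twoCoset (V.map (Int.castRingHom (ZMod ℓ₂))).toAffine.Point 0 := by
      refine ⟨reduceMod V ℓ₂ hℓ₂ v, 0, by simp, ?_⟩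
      rw [two_zsmul, add_zero, ← two_nsmul, ← map_nsmul, hv, hT₄def, reduceMod_some V ℓ₂ hℓ₂ e₄]
    exact not_mem_twoCoset_of_xDoubleFree V ℓ₂ hB₃ _ hmem
  rcases fourTorsion_eq V hT hT2 h₄ htan ℓ₁ hℓ₁ hodd hB₁ hB₂ (2 • w) h42w with
    h0 | h1 | h2 | h3
  · rw [show (4 : ℕ) = 2 * 2 from rfl, mul_nsmul, h0, nsmul_zero]
  · exact absurd h1 (hnot w)
  · -- `2w = T₄ + T₄ = T`, so `4w = 2T = 0`
    have h2T₄ : T₄ + T₄ = T := some_add_self_of_intTangent V hΔ h₄ hT htan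
    rw [show (4 : ℕ) = 2 * 2 from rfl, mul_nsmul, h2, h2T₄, h2T]
  · -- `2w = -T₄` gives `2(-w) = T₄`
    exfalso
    apply hnot (-w)
    rw [neg_nsmul, h3, hT₄def, neg_neg]

open scoped Classical in
/-- **`4m` kills `E(ℚ)_tors`** when `t = 2^e·m` does (`annihilatorCheck`) and `E(ℚ)` has no point of
order `8` by `four_nsmul_eq_zero_of_fourTorsionWitness` (descent `2^(k+2)•z = 0 → 4•z = 0`).
[cite: SilvermanAEC2009, Prop. VII.3.1(b), Thm. VII.3.4] -/
theorem torsion_zsmul_eq_zero_of_fourTorsionWitness {S : List (ℕ × ℕ)} {t e m : ℕ}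
    (hte : t = 2 ^ e * m)
    (hS : ∀ ℓN ∈ S, ℓN.1.Prime ∧
      ∀ (x : (V.map (Int.castRingHom ℚ)).toAffine.Point) (n : ℕ), ¬ ℓN.1 ∣ n → n • x = 0 →
        ℓN.2 • x = 0)
    (ht : annihilatorCheck S t = true) {xT yT x₄ y₄ : ℤ}
    (hT : yT ^ 2 + V.a₁ * xT * yT + V.a₃ * yT = xT ^ 3 + V.a₂ * xT ^ 2 + V.a₄ * xT + V.a₆)
    (hT2 : 2 * yT + V.a₁ * xT + V.a₃ = 0)
    (h₄ : y₄ ^ 2 + V.a₁ * x₄ * y₄ + V.a₃ * y₄ = x₄ ^ 3 + V.a₂ * x₄ ^ 2 + V.a₄ * x₄ + V.a₆)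
    (htan : intTangent V x₄ y₄ xT yT = true)
    (ℓ₁ : ℕ) [Fact ℓ₁.Prime] (hℓ₁ : ¬ (ℓ₁ : ℤ) ∣ V.Δ) (hodd : ℓ₁ ≠ 2)
    (hB₁ : twoTorsionOnlyB V ℓ₁ xT yT = true) (hB₂ : halfTOnlyB V ℓ₁ xT x₄ y₄ = true)
    (ℓ₂ : ℕ) [Fact ℓ₂.Prime] (hℓ₂ : ¬ (ℓ₂ : ℤ) ∣ V.Δ) (hB₃ : xDoubleFree V ℓ₂ (x₄ : ZMod ℓ₂) = true)
    (x : (V.map (Int.castRingHom ℚ)).toAffine.Point) (hx : IsOfFinAddOrder x) :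
    ((2 : ℤ) ^ 2 * (m : ℤ)) • x = 0 := by
  have htx : t • x = 0 := nsmul_eq_zero_of_annihilatorCheck hS ht hx
  rw [hte, mul_nsmul'] at htx
  rw [show ((2 : ℤ) ^ 2 * (m : ℤ)) = ((4 * m : ℕ) : ℤ) by push_cast; ring, natCast_zsmul, mul_nsmul']
  -- descend: `2^(k+2) • z = 0 → 4 • z = 0`
  have key : ∀ k : ℕ, ∀ z : (V.map (Int.castRingHom ℚ)).toAffine.Point,
      2 ^ (k + 2) • z = 0 → 4 • z = 0 := by
    intro k
    induction k with
    | zero => intro z hz; simpa using hz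
    | succ k ih =>
      intro z hz
      apply ih
      have hz8 : 8 • (2 ^ k • z) = 0 := by
        rw [← mul_nsmul', show 8 * 2 ^ k = 2 ^ (k + 1 + 2) by ring]; exact hz
      have h4 := four_nsmul_eq_zero_of_fourTorsionWitness V hT hT2 h₄ htan ℓ₁ hℓ₁ hodd hB₁ hB₂ ℓ₂
        hℓ₂ hB₃ (2 ^ k • z) hz8
      rwa [← mul_nsmul', show 4 * 2 ^ k = 2 ^ (k + 2) by ring] at h4
  match e, htx with
  | 0, htx => rw [pow_zero, one_nsmul] at htx; rw [htx, nsmul_zero]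
  | 1, htx =>
      rw [pow_one] at htx
      rw [show (4 : ℕ) = 2 * 2 from rfl, mul_nsmul, htx, nsmul_zero]
  | k + 2, htx => exact key k _ htx

end FourTorsionWitness

/-! ### The rank-2 certificate variants -/

section Assembly

variable (V : WeierstrassCurve ℤ)

/-- **Rank-2 kernel certificate with coset tests modulo the rational `2`-torsion** (`E(ℚ)[2] ≅ ℤ/2`):
integral points `P₁, P₂`; torsion annihilator `t = 2^e·m` from kernel point counts; the rational
`2`-torsion point `T = (x_T, y_T)` with a good odd prime `ℓ₁` where `T̃` is the only `2`-torsion point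
(`E(ℚ)[2] = {O, T}`) and a good prime `ℓ₂` where `T̃` is no double (no rational `4`-torsion, so `2m`
kills `E(ℚ)_tors`); for each of `P₁`, `P₂`, `P₁ + P₂` a good prime `q` with `tCosetFree`
(`R̃, R̃ + T̃ ∉ 2Ẽ(𝔽_q)`), the sum supplied by a chord certificate mod `q₁₂`. Then `2 ≤ rank_ℤ E(ℚ)`.
[cite: CremonaAlgorithms1997, §3.5] [cite: SilvermanAEC2009, Thm. VIII.6.7] -/
theorem two_le_mordellWeilRank_of_kernelCertT3 {X₁ Y₁ X₂ Y₂ : ℤ}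
    (h₁ : Y₁ ^ 2 + V.a₁ * X₁ * Y₁ + V.a₃ * Y₁ = X₁ ^ 3 + V.a₂ * X₁ ^ 2 + V.a₄ * X₁ + V.a₆)
    (h₂ : Y₂ ^ 2 + V.a₁ * X₂ * Y₂ + V.a₃ * Y₂ = X₂ ^ 3 + V.a₂ * X₂ ^ 2 + V.a₄ * X₂ + V.a₆)
    {S : List (ℕ × ℕ)} {t e m : ℕ} (hm : m % 2 = 1) (hte : t = 2 ^ e * m)
    (hS : ∀ ℓN ∈ S, ℓN.1.Prime ∧
      ∀ (x : (V.map (Int.castRingHom ℚ)).toAffine.Point) (n : ℕ), ¬ ℓN.1 ∣ n → n • x = 0 →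
        ℓN.2 • x = 0)
    (ht : annihilatorCheck S t = true)
    {xT yT : ℤ}
    (hT : yT ^ 2 + V.a₁ * xT * yT + V.a₃ * yT = xT ^ 3 + V.a₂ * xT ^ 2 + V.a₄ * xT + V.a₆)
    (hT2 : 2 * yT + V.a₁ * xT + V.a₃ = 0)
    (ℓ₁ : ℕ) [Fact ℓ₁.Prime] (hℓ₁ : ¬ (ℓ₁ : ℤ) ∣ V.Δ) (hodd : ℓ₁ ≠ 2)
    (hB₁ : twoTorsionOnlyB V ℓ₁ xT yT = true)
    (ℓ₂ : ℕ) [Fact ℓ₂.Prime] (hℓ₂ : ¬ (ℓ₂ : ℤ) ∣ V.Δ) (hB₂ : xDoubleFree V ℓ₂ (xT : ZMod ℓ₂) = true)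
    (q₁ q₂ q₁₂ : ℕ) [Fact q₁.Prime] [Fact q₂.Prime] [Fact q₁₂.Prime]
    (hq₁ : ¬ (q₁ : ℤ) ∣ V.Δ) (hq₂ : ¬ (q₂ : ℤ) ∣ V.Δ) (hq₁₂ : ¬ (q₁₂ : ℤ) ∣ V.Δ)
    {A₁ B₁ : ℤ}
    (hw₁ : tCosetFree V q₁ (xT : ZMod q₁) (yT : ZMod q₁) (X₁ : ZMod q₁) (Y₁ : ZMod q₁)
      (A₁ : ZMod q₁) (B₁ : ZMod q₁) = true)
    {A₂ B₂ : ℤ}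
    (hw₂ : tCosetFree V q₂ (xT : ZMod q₂) (yT : ZMod q₂) (X₂ : ZMod q₂) (Y₂ : ZMod q₂)
      (A₂ : ZMod q₂) (B₂ : ZMod q₂) = true)
    {X₁₂ Y₁₂ A₁₂ B₁₂ : ℤ}
    (hc₁₂ : zmodChord V q₁₂ (X₁ : ZMod q₁₂) (Y₁ : ZMod q₁₂) (X₂ : ZMod q₁₂) (Y₂ : ZMod q₁₂)
      (X₁₂ : ZMod q₁₂) (Y₁₂ : ZMod q₁₂) = true)
    (hw₁₂ : tCosetFree V q₁₂ (xT : ZMod q₁₂) (yT : ZMod q₁₂) (X₁₂ : ZMod q₁₂) (Y₁₂ : ZMod q₁₂)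
      (A₁₂ : ZMod q₁₂) (B₁₂ : ZMod q₁₂) = true) :
    2 ≤ (V.map (Int.castRingHom ℚ)).mordellWeilRank := by
  classical
  have hΔ : V.Δ ≠ 0 := Δ_ne_zero_of_not_dvd V hq₁
  haveI := isElliptic_rat V hΔ
  have hm' : Odd (m : ℤ) := by exact_mod_cast Nat.odd_iff.mpr hm
  have htors : ∀ x : (V.map (Int.castRingHom ℚ)).toAffine.Point, IsOfFinAddOrder x →
      ((2 : ℤ) ^ 1 * (m : ℤ)) • x = 0 :=
    fun x hx => torsion_zsmul_eq_zero_of_twoTorsionWitness V hte hS ht hT hT2 ℓ₁ hℓ₁ hodd hB₁ ℓ₂ hℓ₂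
      hB₂ x hx
  have h2 := twoTorsion_eq_zero_or_eq V hT hT2 ℓ₁ hℓ₁ hodd hB₁
  have eT : V.toAffine.Equation xT yT := (Affine.equation_iff xT yT).mpr hT
  have e₁ : V.toAffine.Equation X₁ Y₁ := (Affine.equation_iff X₁ Y₁).mpr h₁
  have e₂ : V.toAffine.Equation X₂ Y₂ := (Affine.equation_iff X₂ Y₂).mpr h₂
  refine two_le_mordellWeilRank_of_cosetWitness (V.map (Int.castRingHom ℚ)) hm' htors
    (P₁ := .some _ _ (nonsingular_rat_of_eq V hΔ h₁))
    (P₂ := .some _ _ (nonsingular_rat_of_eq V hΔ h₂))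
    (AddMonoidHom.id _) (AddMonoidHom.id _) (AddMonoidHom.id _) ?_ ?_ ?_
  · exact not_mem_twoCoset_one_of_tCosetFree V q₁ hq₁ h2 (reduceMod_some V q₁ hq₁ eT _)
      (reduceMod_some V q₁ hq₁ e₁ _) hw₁
  · exact not_mem_twoCoset_one_of_tCosetFree V q₂ hq₂ h2 (reduceMod_some V q₂ hq₂ eT _)
      (reduceMod_some V q₂ hq₂ e₂ _) hw₂
  · obtain ⟨h', e⟩ := exists_some_add_some_of_zmodChord V q₁₂
      (nonsingular_zmod_of_equation V q₁₂ hq₁₂ e₁) (nonsingular_zmod_of_equation V q₁₂ hq₁₂ e₂) hc₁₂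
    refine not_mem_twoCoset_one_of_tCosetFree V q₁₂ hq₁₂ h2 (hns := h')
      (reduceMod_some V q₁₂ hq₁₂ eT _) ?_ hw₁₂
    rw [AddMonoidHom.id_apply, map_add, reduceMod_some V q₁₂ hq₁₂ e₁, reduceMod_some V q₁₂ hq₁₂ e₂, e]

/-- **Rank-2 kernel certificate for `E(ℚ)_tors ⊇ ℤ/4`**: integral points `P₁, P₂`; torsion
annihilator `t = 2^e·m` from kernel point counts; integral `T = (x_T, y_T)` with
`2y_T + a₁x_T + a₃ = 0` and `T₄ = (x₄, y₄)` with `2T₄ = T` (`intTangent`); a good odd prime `ℓ₁` with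
`twoTorsionOnlyB` and `halfTOnlyB` (`E(ℚ)[4] = {O, ±T₄, T}`) and a good prime `ℓ₂` at which `T̃₄` is
no double (no rational `8`-torsion, so `4m` kills `E(ℚ)_tors`); for each of `P₁`, `P₂`, `P₁ + P₂` a
good prime `q` with `tCosetFree` w.r.t. `T̃₄` (`R̃, R̃ + T̃₄ ∉ 2Ẽ(𝔽_q)`), the sum supplied by a chord
certificate mod `q₁₂`. Then `2 ≤ rank_ℤ E(ℚ)`.
[cite: CremonaAlgorithms1997, §3.5] [cite: SilvermanAEC2009, Thm. VIII.6.7] -/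
theorem two_le_mordellWeilRank_of_kernelCertT4 {X₁ Y₁ X₂ Y₂ : ℤ}
    (h₁ : Y₁ ^ 2 + V.a₁ * X₁ * Y₁ + V.a₃ * Y₁ = X₁ ^ 3 + V.a₂ * X₁ ^ 2 + V.a₄ * X₁ + V.a₆)
    (h₂ : Y₂ ^ 2 + V.a₁ * X₂ * Y₂ + V.a₃ * Y₂ = X₂ ^ 3 + V.a₂ * X₂ ^ 2 + V.a₄ * X₂ + V.a₆)
    {S : List (ℕ × ℕ)} {t e m : ℕ} (hm : m % 2 = 1) (hte : t = 2 ^ e * m)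
    (hS : ∀ ℓN ∈ S, ℓN.1.Prime ∧
      ∀ (x : (V.map (Int.castRingHom ℚ)).toAffine.Point) (n : ℕ), ¬ ℓN.1 ∣ n → n • x = 0 →
        ℓN.2 • x = 0)
    (ht : annihilatorCheck S t = true)
    {xT yT x₄ y₄ : ℤ}
    (hT : yT ^ 2 + V.a₁ * xT * yT + V.a₃ * yT = xT ^ 3 + V.a₂ * xT ^ 2 + V.a₄ * xT + V.a₆)
    (hT2 : 2 * yT + V.a₁ * xT + V.a₃ = 0)
    (h₄ : y₄ ^ 2 + V.a₁ * x₄ * y₄ + V.a₃ * y₄ = x₄ ^ 3 + V.a₂ * x₄ ^ 2 + V.a₄ * x₄ + V.a₆)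
    (htan : intTangent V x₄ y₄ xT yT = true)
    (ℓ₁ : ℕ) [Fact ℓ₁.Prime] (hℓ₁ : ¬ (ℓ₁ : ℤ) ∣ V.Δ) (hodd : ℓ₁ ≠ 2)
    (hB₁ : twoTorsionOnlyB V ℓ₁ xT yT = true) (hB₂ : halfTOnlyB V ℓ₁ xT x₄ y₄ = true)
    (ℓ₂ : ℕ) [Fact ℓ₂.Prime] (hℓ₂ : ¬ (ℓ₂ : ℤ) ∣ V.Δ) (hB₃ : xDoubleFree V ℓ₂ (x₄ : ZMod ℓ₂) = true)
    (q₁ q₂ q₁₂ : ℕ) [Fact q₁.Prime] [Fact q₂.Prime] [Fact q₁₂.Prime]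
    (hq₁ : ¬ (q₁ : ℤ) ∣ V.Δ) (hq₂ : ¬ (q₂ : ℤ) ∣ V.Δ) (hq₁₂ : ¬ (q₁₂ : ℤ) ∣ V.Δ)
    {A₁ B₁ : ℤ}
    (hw₁ : tCosetFree V q₁ (x₄ : ZMod q₁) (y₄ : ZMod q₁) (X₁ : ZMod q₁) (Y₁ : ZMod q₁)
      (A₁ : ZMod q₁) (B₁ : ZMod q₁) = true)
    {A₂ B₂ : ℤ}
    (hw₂ : tCosetFree V q₂ (x₄ : ZMod q₂) (y₄ : ZMod q₂) (X₂ : ZMod q₂) (Y₂ : ZMod q₂)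
      (A₂ : ZMod q₂) (B₂ : ZMod q₂) = true)
    {X₁₂ Y₁₂ A₁₂ B₁₂ : ℤ}
    (hc₁₂ : zmodChord V q₁₂ (X₁ : ZMod q₁₂) (Y₁ : ZMod q₁₂) (X₂ : ZMod q₁₂) (Y₂ : ZMod q₁₂)
      (X₁₂ : ZMod q₁₂) (Y₁₂ : ZMod q₁₂) = true)
    (hw₁₂ : tCosetFree V q₁₂ (x₄ : ZMod q₁₂) (y₄ : ZMod q₁₂) (X₁₂ : ZMod q₁₂) (Y₁₂ : ZMod q₁₂)
      (A₁₂ : ZMod q₁₂) (B₁₂ : ZMod q₁₂) = true) :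
    2 ≤ (V.map (Int.castRingHom ℚ)).mordellWeilRank := by
  classical
  have hΔ : V.Δ ≠ 0 := Δ_ne_zero_of_not_dvd V hq₁
  haveI := isElliptic_rat V hΔ
  have hm' : Odd (m : ℤ) := by exact_mod_cast Nat.odd_iff.mpr hm
  have htors : ∀ x : (V.map (Int.castRingHom ℚ)).toAffine.Point, IsOfFinAddOrder x →
      ((2 : ℤ) ^ 2 * (m : ℤ)) • x = 0 :=
    fun x hx => torsion_zsmul_eq_zero_of_fourTorsionWitness V hte hS ht hT hT2 h₄ htan ℓ₁ hℓ₁ hodd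
      hB₁ hB₂ ℓ₂ hℓ₂ hB₃ x hx
  have h4 := fourTorsion_eq V hT hT2 h₄ htan ℓ₁ hℓ₁ hodd hB₁ hB₂
  have e₄ : V.toAffine.Equation x₄ y₄ := (Affine.equation_iff x₄ y₄).mpr h₄
  have e₁ : V.toAffine.Equation X₁ Y₁ := (Affine.equation_iff X₁ Y₁).mpr h₁
  have e₂ : V.toAffine.Equation X₂ Y₂ := (Affine.equation_iff X₂ Y₂).mpr h₂
  refine two_le_mordellWeilRank_of_cosetWitness (V.map (Int.castRingHom ℚ)) hm' htors
    (P₁ := .some _ _ (nonsingular_rat_of_eq V hΔ h₁))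
    (P₂ := .some _ _ (nonsingular_rat_of_eq V hΔ h₂))
    (AddMonoidHom.id _) (AddMonoidHom.id _) (AddMonoidHom.id _) ?_ ?_ ?_
  · exact not_mem_twoCoset_two_of_tCosetFree V q₁ hq₁ h4 (reduceMod_some V q₁ hq₁ e₄ _)
      (reduceMod_some V q₁ hq₁ e₁ _) hw₁
  · exact not_mem_twoCoset_two_of_tCosetFree V q₂ hq₂ h4 (reduceMod_some V q₂ hq₂ e₄ _)
      (reduceMod_some V q₂ hq₂ e₂ _) hw₂
  · obtain ⟨h', e⟩ := exists_some_add_some_of_zmodChord V q₁₂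
      (nonsingular_zmod_of_equation V q₁₂ hq₁₂ e₁) (nonsingular_zmod_of_equation V q₁₂ hq₁₂ e₂) hc₁₂
    refine not_mem_twoCoset_two_of_tCosetFree V q₁₂ hq₁₂ h4 (hns := h')
      (reduceMod_some V q₁₂ hq₁₂ e₄ _) ?_ hw₁₂
    rw [AddMonoidHom.id_apply, map_add, reduceMod_some V q₁₂ hq₁₂ e₁, reduceMod_some V q₁₂ hq₁₂ e₂, e]

end Assembly

end Summit.BirchSwinnertonDyer.BirchSwinnertonDyer.Rank2Observatory
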